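import Literature.Computability.AlgebraicComplexity.BDI20SemistandardHwvTableau
import Literature.Computability.AlgebraicComplexity.BDI20GridLikeLayeredGraphs
import HarnessLib

/-!
# Bläser–Dörfler–Ikenmeyer 2020, Lemma 25 ⇒ Thm 30 (CCC 2021 Lemma 8.4 ⇒ Thm 8.9): the tableau of an
# 8-regular grid-like layered multigraph is a YES-instance iff the graph is properly 3-colourable

M. Bläser, J. Dörfler, C. Ikenmeyer, *On the complexity of evaluating highest weight vectors*,
arXiv:2002.11594 (= CCC 2021, LIPIcs 200:29), §8: Lemma 25 [8.4] (the two semistandard two-row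
tableaux `T̂_↕`, `T̂_↔` of a grid-like layered multigraph) feeding Thm 30 [8.9] (the five-row
tableau `T̂`). Cell `val-lit`, seat x6 g8 (closer-owner, RULING (124)): the GLUE between t20 g10's
`BDI20GridLikeLayeredGraphs.lean` (Def. 24, Lemma 25: `GridLikeLayered n`, `interCols`,
`intraCols`) and x6 g8's `BDI20SemistandardHwvTableau.lean` (Thm 30's construction from a
`Thm30.IsTwoRowInstance`). HONEST FRAMING: a step of a printed NP-hardness proof about EVALUATING
highest weight vectors; nothing here bears on `VP ≠ VNP`, which is NOT proved. Theorem-only file: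
no definition, no fact, no `instance`; `0` sorries.

* `GridLikeLayered.isTwoRowInstance` — for an `8`-regular `G`, `(n, T̂_↕, T̂_↔)` satisfies every
  hypothesis of Thm 30's construction (two-box columns, both semistandard, labels `< n`, every
  label in `T̂_↕` — "every vertex of a grid-like layered graph is incident to an edge going to
  another layer" —, every label exactly `8` times — "`8`-regular").
* `GridLikeLayered.colourable3_cols_iff` — proper 3-colourings of `G` ↔ 3-colourings injective on
  every column of `T̂_↕ T̂_↔` ("every edge of `G` is represented by a column").
* ★ `GridLikeLayered.tableau_mem_nonvanishingSetSemistd_iff` — for `k ≥ 1`, `m ≥ 5`: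
  `Thm30.tableau k G.interCols G.intraCols ∈ nonvanishingSetSemistd (16k) m ↔ ∃ c, G.IsProper3 c`
  ("We reduce from checking whether an `8`-regular grid-like layered graph allows for a proper
  `3`-coloring").

## References
* [BlaserDorflerIkenmeyer2020] arXiv:2002.11594 Lemma 25, Thm 30 and its proof (= CCC 2021
  Lemma 8.4, Thm 8.9).
-/

namespace Literature.Computability.AlgebraicComplexity

namespace BDI2020

namespace GridLikeLayered

variable {n : ℕ} (G : GridLikeLayered n)

/-- The new labels are onto `{0, …, n-1}`. [cite: BlaserDorflerIkenmeyer2020, Lemma 25, proof (arXiv; = CCC 2021 Lemma 8.4)] -/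
theorem exists_label_eq {v : ℕ} (hv : v < n) : ∃ w, G.label w = v := by
  obtain ⟨w, hw⟩ := G.labelFin_bijective.2 ⟨v, hv⟩
  exact ⟨w, by simpa [labelFin] using congrArg Fin.val hw⟩

/-- **Lemma 25 delivers a two-row instance for Thm 30**: for an `8`-regular grid-like layered
multigraph, `(T̂_↕, T̂_↔)` satisfies every hypothesis of Thm 30's construction (two-box columns,
both semistandard, labels `< n`, every label in `T̂_↕`, every label `8` times).
[cite: BlaserDorflerIkenmeyer2020, Lemma 25 and Thm 30 (proof) (arXiv; = CCC 2021 Lemma 8.4, Thm 8.9)] -/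
theorem isTwoRowInstance (h8 : G.IsRegular 8) : Thm30.IsTwoRowInstance n G.interCols G.intraCols where
  length_inter := fun _ hc => G.length_of_mem_interCols hc
  length_intra := fun _ hc => G.length_of_mem_intraCols hc
  semistandard_inter := G.isSemistandard_interCols
  semistandard_intra := G.isSemistandard_intraCols
  lt_inter := by
    intro c hc u hu
    obtain ⟨a, b, -, rfl⟩ := G.mem_interCols_iff.1 hc
    simp only [col, List.mem_cons, List.not_mem_nil, or_false] at hu
    rcases hu with rfl | rfl <;> exact G.label_lt _
  lt_intra := by
    intro c hc u hu
    obtain ⟨a, b, -, rfl⟩ := G.mem_intraCols_iff.1 hc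
    simp only [col, List.mem_cons, List.not_mem_nil, or_false] at hu
    rcases hu with rfl | rfl <;> exact G.label_lt _
  cover := by
    intro v hv
    obtain ⟨w, rfl⟩ := G.exists_label_eq hv
    exact G.exists_mem_interCols_label_mem w
  degree := by
    intro v hv
    obtain ⟨w, rfl⟩ := G.exists_label_eq hv
    exact G.sum_count_label_of_isRegular h8 w

/-- A two-box column in the new labels carries distinct colours iff its ends do. [cite: BlaserDorflerIkenmeyer2020, Lemma 25 (arXiv; = CCC 2021 Lemma 8.4)] -/
private theorem nodup_map_col_iff (φ : ℕ → ℕ) (u v : Fin n) :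
    ((G.col u v).map φ).Nodup ↔ φ (G.label u) ≠ φ (G.label v) := by
  simp [col, List.nodup_cons]

/-- **3-colourings of `G` are 3-colourings of the column hypergraph `T̂_↕ T̂_↔` and conversely**
(Lemma 25: `E = E(G_{T̂_↕}) ∪ E(G_{T̂_↔})` after relabelling).
[cite: BlaserDorflerIkenmeyer2020, Lemma 25 and Thm 30 (proof: "every edge of G is represented by a column") (arXiv; = CCC 2021 Lemma 8.4, Thm 8.9)] -/
theorem colourable3_cols_iff :
    Thm30.Colourable3 (G.interCols ++ G.intraCols) ↔ ∃ c : Fin n → Fin 3, G.IsProper3 c := by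
  constructor
  · rintro ⟨col, hcol, hnd⟩
    refine ⟨fun w => ⟨col (G.label w), hcol _⟩, fun u v huv heq => ?_⟩
    have heq' : col (G.label u) = col (G.label v) := congrArg Fin.val heq
    rcases (G.mult_pos_iff_mem_cols u v).1 huv with hm | hm
    · exact (G.nodup_map_col_iff col u v).1 (hnd _ hm) heq'
    · exact (G.nodup_map_col_iff col v u).1 (hnd _ hm) heq'.symm
  · rintro ⟨c, hc⟩
    let φ : ℕ → ℕ := fun x =>
      if h : x < n then (c (Fintype.bijInv G.labelFin_bijective ⟨x, h⟩)).val else 0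
    have hφ : ∀ w, φ (G.label w) = (c w).val := by
      intro w
      simp only [φ, dif_pos (G.label_lt w)]
      have : Fintype.bijInv G.labelFin_bijective ⟨G.label w, G.label_lt w⟩ = w :=
        Fintype.leftInverse_bijInv G.labelFin_bijective w
      rw [this]
    refine ⟨φ, fun x => ?_, fun d hd => ?_⟩
    · simp only [φ]
      split_ifs
      · exact Fin.is_lt _
      · norm_num
    · have key : ∀ u v, 0 < G.mult u v → ((G.col u v).map φ).Nodup := by
        intro u v huv
        rw [G.nodup_map_col_iff, hφ, hφ]
        exact fun h => hc u v huv (Fin.ext h)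
      rcases List.mem_append.1 hd with hd | hd
      · obtain ⟨u, v, huv, rfl⟩ := G.mem_interCols_iff.1 hd
        exact key u v huv.1
      · obtain ⟨u, v, huv, rfl⟩ := G.mem_intraCols_iff.1 hd
        exact key u v huv.1

/-- **Thm 30's reduction from `8`-regular grid-like layered multigraphs, by name**: for `k ≥ 1`,
`m ≥ 5`, the tableau `T̂` built from `(T̂_↕, T̂_↔)` of Lemma 25 is a YES-instance of the evaluation
problem of Thm 8.9 for `(d, m) = (16k, m)` iff `G` is properly 3-colourable.
[cite: BlaserDorflerIkenmeyer2020, Thm 30 (arXiv; = CCC 2021 Thm 8.9), proof ("We reduce from checking whether an 8-regular grid-like layered graph allows for a proper 3-coloring")] -/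
theorem tableau_mem_nonvanishingSetSemistd_iff (h8 : G.IsRegular 8) {k m : ℕ} (hk : 0 < k)
    (hm : 5 ≤ m) :
    Thm30.tableau k G.interCols G.intraCols ∈ nonvanishingSetSemistd (16 * k) m ↔
      ∃ c : Fin n → Fin 3, G.IsProper3 c := by
  rw [Thm30.tableau_mem_nonvanishingSetSemistd_iff (G.isTwoRowInstance h8) hk hm, G.colourable3_cols_iff]

end GridLikeLayered

end BDI2020

end Literature.Computability.AlgebraicComplexity
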